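import Summits.ResolutionOfSingularities.ResolutionOfSingularities.Theorems.MarkedTransferCampaignW46FiniteExitBoundTransform
import Summits.ResolutionOfSingularities.ResolutionOfSingularities.Theorems.MarkedTransferCampaignW46ExitTree
import Literature.AlgebraicGeometry.Resolution.KollarBlowupSequenceFunctors
import HarnessLib

/-!
# [OURS · L1 W4.6 rung (i-a)′] Dictionary, part 4: the blown-up point and the points over it as MARKED NODES of
# res-L1-s46-pv-8's marked quadratic tree (cell res-hironaka, LADDER-RESOLUTION rung L, D-0089; campaign s46, seat
# res-D-pv-046 AS res-L1-s46-pv-9; host route MarkedTransfer, `--supports stmt-ResolutionOfSingularities-16156 --as helper`)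

HONEST FRAMING. Nothing here is a statement of H. Hironaka's manuscript (2017-03-23, [Hironaka2017]) and nothing here
asserts that any statement of it holds. OURS bookkeeping joining this seat's dictionary (parts 1–3: p501974, p503229, the
`…Transform` file) to res-L1-s46-pv-8's marked quadratic tree (`…W46ExitTree.lean`, p500395: `ctrlTransform`, `MarkedNode`,
`IsTameNode`, `exitCount`). The local rings are now read in `K(Z)` as RANGES of ring homomorphisms (`(𝒪_{Z,ξ} → K(Z)).range`,
`(ε_{ξ′} : 𝒪_{Z′,ξ′} → K(Z)).range`), the currency of `germExitCount_eq_exitCount` (`…W46ExitTreeGerm.lean`). AI review is weaker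
than expert review. No `sorry`; axioms standard.

## Contents (namespace `…CampaignW46`)

* `toSubring_fibreSubalgebra_eq_range` — `S_{ξ′} = ε_{ξ′}(𝒪_{Z′,ξ′})` as the range of `ε_{ξ′}`; `isQuadraticTransform_range_stalkEmb`,
  `subringDominates_range_stalkEmb`, `eq_of_range_stalkEmb_eq` (injectivity), `exists_frac_stalkEmb` (every element of `K(Z)` is a
  fraction of elements of `ε_{ξ′}(𝒪_{Z′,ξ′})`) — parts 2–3 in range currency.
* `map_rangeRestrict_maximalIdeal`, `isRegularLocalRing_range_of`, `ringKrullDim_range_algebraMap_stalk`, `ringKrullDim_range_stalkEmb`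
  — the ranges are isomorphic to the stalks (regularity, dimension, maximal ideal).
* **`map_rangeRestrict_stalkIdeal_transform_eq_ctrlTransform`** — the IDEAL IDENTITY in pv-8's currency: the stalk at `ξ′` of the
  transform `E′` (Def. 2.1), read in `ε_{ξ′}(𝒪_{Z′,ξ′})`, IS `ctrlTransform b R I S_{ξ′}` for `R = 𝒪_{Z,ξ}`, `I = J_ξ` read in `K(Z)`.
* **`isTameNode_range_of_regime`** — the ROOT NODE `⟨R, I⟩` is a TAME node of exponent `b` when `dim 𝒪_{Z,ξ} = 2`, `ξ ∈ Sing(E)`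
  and the transform lies in `regimePlaneIsolated` (isolation/tameness from part 1).

## References

* res-L1-s46-pv-8 (res-D-pv-044), `Theorems/MarkedTransferCampaignW46ExitTree*.lean` (HOME/STATUS 2026-08-27T05:18:01Z, 05:57:02Z).
* O. Zariski, P. Samuel, *Commutative Algebra* II (1960), Appendix 5. [ZariskiSamuel1960]
* S. D. Cutkosky, Math. Ann. 362 (2015), §2.1. [Cutkosky2014]
-/

noncomputable section

set_option linter.dupNamespace false -- mandated namespace of this single-conjunct summit

open CategoryTheory AlgebraicGeometry TopologicalSpace IsLocalRing

namespace Summit.ResolutionOfSingularities.ResolutionOfSingularities.Theorems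

namespace CampaignW46

open Literature.AlgebraicGeometry.Resolution
open Literature.AlgebraicGeometry.Hironaka2017.S02Preliminaries
open Scheme.IdealSheafData

universe u

section RangeCurrency

variable {Z Z' : Scheme.{u}} [IsIntegral Z] {π : Z' ⟶ Z} {J : Z.IdealSheafData}

/-! ## The base ring `R = (𝒪_{Z,ξ} → K(Z)).range` -/

/-- The maximal ideal of `R` is the image of `𝔪_ξ`. [folklore] -/
theorem map_rangeRestrict_maximalIdeal (ξ : Z) :
    haveI := isLocalRing_range_algebraMap_stalk (Z := Z) ξ
    (maximalIdeal (Z.presheaf.stalk ξ)).map (algebraMap (Z.presheaf.stalk ξ) Z.functionField).rangeRestrict =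
      maximalIdeal (algebraMap (Z.presheaf.stalk ξ) Z.functionField).range := by
  haveI := isLocalRing_range_algebraMap_stalk (Z := Z) ξ
  set ι := algebraMap (Z.presheaf.stalk ξ) Z.functionField
  let e : Z.presheaf.stalk ξ ≃+* ι.range := RingEquiv.ofBijective ι.rangeRestrict
    ⟨fun _ _ h => algebraMap_stalk_functionField_injective ξ (congrArg Subtype.val h), ι.rangeRestrict_surjective⟩
  have hemax : ∀ a, a ∈ maximalIdeal (Z.presheaf.stalk ξ) ↔ e a ∈ maximalIdeal ι.range := fun a => by
    rw [mem_maximalIdeal, mem_maximalIdeal, mem_nonunits_iff, mem_nonunits_iff, MulEquiv.isUnit_map]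
  change (maximalIdeal (Z.presheaf.stalk ξ)).map e.toRingHom = _
  refine le_antisymm ((Ideal.map_le_iff_le_comap).mpr fun a ha => ?_) fun r hr => ?_
  · rw [Ideal.mem_comap]
    exact (hemax a).mp ha
  · obtain ⟨a, rfl⟩ := e.surjective r
    exact Ideal.mem_map_of_mem _ ((hemax a).mpr hr)

/-- `R ≅ 𝒪_{Z,ξ}` is a regular local ring when `𝒪_{Z,ξ}` is. [folklore] -/
theorem isRegularLocalRing_range_of (ξ : Z) [IsRegularLocalRing (Z.presheaf.stalk ξ)] :
    IsRegularLocalRing (algebraMap (Z.presheaf.stalk ξ) Z.functionField).range :=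
  IsRegularLocalRing.of_ringEquiv (RingEquiv.ofBijective (algebraMap (Z.presheaf.stalk ξ) Z.functionField).rangeRestrict
    ⟨fun _ _ h => algebraMap_stalk_functionField_injective ξ (congrArg Subtype.val h),
      (algebraMap (Z.presheaf.stalk ξ) Z.functionField).rangeRestrict_surjective⟩)

/-- `dim R = dim 𝒪_{Z,ξ}`. [folklore] -/
theorem ringKrullDim_range_algebraMap_stalk (ξ : Z) :
    ringKrullDim (algebraMap (Z.presheaf.stalk ξ) Z.functionField).range = ringKrullDim (Z.presheaf.stalk ξ) :=
  (ringKrullDim_eq_of_ringEquiv (RingEquiv.ofBijective (algebraMap (Z.presheaf.stalk ξ) Z.functionField).rangeRestrict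
    ⟨fun _ _ h => algebraMap_stalk_functionField_injective ξ (congrArg Subtype.val h),
      (algebraMap (Z.presheaf.stalk ξ) Z.functionField).rangeRestrict_surjective⟩)).symm

/-! ## The rings over `ξ`: `S_{ξ′} = ε_{ξ′}(𝒪_{Z′,ξ′})` as a range -/

variable [IsLocallyNoetherian Z]

/-- `S_{ξ′}` (the fibre subalgebra) is the range of `ε_{ξ′}`. [folklore] -/
theorem toSubring_fibreSubalgebra_eq_range (hπ : IsBlowup π J) {ξ : Z} {ξ' : Z'} (h : π ξ' = ξ) :
    (hπ.fibreSubalgebra ξ ξ' h).toSubring = (hπ.stalkEmb ξ').range := by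
  ext z
  rw [Subalgebra.mem_toSubring, hπ.mem_fibreSubalgebra_iff, RingHom.mem_range]

/-- `dim ε_{ξ′}(𝒪_{Z′,ξ′}) = dim 𝒪_{Z′,ξ′}`. [folklore] -/
theorem ringKrullDim_range_stalkEmb (hπ : IsBlowup π J) (ξ' : Z') :
    ringKrullDim (hπ.stalkEmb ξ').range = ringKrullDim (Z'.presheaf.stalk ξ') :=
  (ringKrullDim_eq_of_ringEquiv (RingEquiv.ofBijective (hπ.stalkEmb ξ').rangeRestrict
    ⟨fun _ _ h => hπ.stalkEmb_injective ξ' (congrArg Subtype.val h), (hπ.stalkEmb ξ').rangeRestrict_surjective⟩)).symm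

/-- `ε_{ξ′}(𝒪_{Z′,ξ′})` is regular when `𝒪_{Z′,ξ′}` is. [folklore] -/
theorem isRegularLocalRing_range_stalkEmb (hπ : IsBlowup π J) (ξ' : Z') [IsRegularLocalRing (Z'.presheaf.stalk ξ')] :
    IsRegularLocalRing (hπ.stalkEmb ξ').range :=
  IsRegularLocalRing.of_ringEquiv (RingEquiv.ofBijective (hπ.stalkEmb ξ').rangeRestrict
    ⟨fun _ _ h => hπ.stalkEmb_injective ξ' (congrArg Subtype.val h), (hπ.stalkEmb ξ').rangeRestrict_surjective⟩)

/-- Every element of `K(Z)` is a fraction of elements of `ε_{ξ′}(𝒪_{Z′,ξ′})` (indeed of `𝒪_{Z,π ξ′}`). [folklore] -/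
theorem exists_frac_stalkEmb (hπ : IsBlowup π J) (ξ' : Z') (z : Z.functionField) :
    ∃ a c : Z'.presheaf.stalk ξ', hπ.stalkEmb ξ' c ≠ 0 ∧ z = hπ.stalkEmb ξ' a / hπ.stalkEmb ξ' c := by
  obtain ⟨a, c, hc, hac⟩ := IsFractionRing.div_surjective (A := Z.presheaf.stalk (π ξ')) z
  refine ⟨(π.stalkMap ξ').hom a, (π.stalkMap ξ').hom c, ?_, ?_⟩
  · rw [hπ.stalkEmb_stalkMap]
    exact (map_ne_zero_iff _ (algebraMap_stalk_functionField_injective (π ξ'))).mpr (nonZeroDivisors.ne_zero hc)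
  · rw [hπ.stalkEmb_stalkMap, hπ.stalkEmb_stalkMap, hac]

variable [IsIntegral Z']

/-- **`ε_{ξ′}(𝒪_{Z′,ξ′})` is a quadratic transform of `R`** (part 2, range currency). [cite: Cutkosky2014, §2.1] -/
theorem isQuadraticTransform_range_stalkEmb (hπ : IsBlowup π J) (ξ' : Z')
    (hJ : stalkIdeal J (π ξ') = maximalIdeal (Z.presheaf.stalk (π ξ'))) :
    IsQuadraticTransform (algebraMap (Z.presheaf.stalk (π ξ')) Z.functionField).range (hπ.stalkEmb ξ').range := by
  rw [← toSubring_fibreSubalgebra_eq_range hπ rfl]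
  exact isQuadraticTransform_fibreSubalgebra hπ ξ' hJ

/-- **Injectivity in range currency**: two points over the same point with `ε_{ξ₁}(𝒪) = ε_{ξ₂}(𝒪)` coincide (part 3).
[cite: StacksProject, Tag 01KM] -/
theorem eq_of_range_stalkEmb_eq (hπ : IsBlowup π J) {ξ₁ ξ₂ : Z'} (h : π ξ₁ = π ξ₂)
    (heq : (hπ.stalkEmb ξ₁).range = (hπ.stalkEmb ξ₂).range) : ξ₁ = ξ₂ := by
  refine eq_of_fibreSubalgebra_eq hπ (ξ := π ξ₂) h rfl (Subalgebra.toSubring_injective ?_)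
  rw [toSubring_fibreSubalgebra_eq_range, toSubring_fibreSubalgebra_eq_range, heq]

/-! ## The ideal identity in `ctrlTransform` currency -/

omit [IsIntegral Z'] in
/-- `ε_{ξ′} ∘ π^♯ = (𝒪_{Z,πξ′} → K(Z))` followed by the inclusion of ranges: the two ring homomorphisms
`𝒪_{Z,π ξ′} → ε_{ξ′}(𝒪_{Z′,ξ′})`. [cite: Kollar2007, §1.4] -/
theorem rangeRestrict_stalkEmb_comp_stalkMap (hπ : IsBlowup π J) (ξ' : Z') :
    ((hπ.stalkEmb ξ').rangeRestrict).comp (π.stalkMap ξ').hom =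
      (Subring.inclusion ((toSubring_fibreSubalgebra_eq_range hπ rfl) ▸ range_algebraMap_stalk_le_fibreSubalgebra hπ ξ')).comp
        (algebraMap (Z.presheaf.stalk (π ξ')) Z.functionField).rangeRestrict := by
  apply RingHom.ext
  intro a
  apply Subtype.ext
  change hπ.stalkEmb ξ' ((π.stalkMap ξ').hom a) = algebraMap (Z.presheaf.stalk (π ξ')) Z.functionField a
  exact hπ.stalkEmb_stalkMap ξ' a

omit [IsIntegral Z'] in
/-- **The ideal identity, in the currency of the marked quadratic tree.** For the blowing up of the closed point `π ξ′`
and an ideal exponent `E = (J, b)`: the stalk at `ξ′` of the transform `E′` (Def. 2.1), read in `ε_{ξ′}(𝒪_{Z′,ξ′})`, is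
`ctrlTransform b R I S_{ξ′} = (I S_{ξ′} : (𝔪_R S_{ξ′})^b)` with `R = (𝒪_{Z,πξ′} → K(Z)).range`, `I` the image of `J_{πξ′}`.
[cite: ZariskiSamuel1960, Appendix 5] -/
theorem map_rangeRestrict_stalkIdeal_transform_eq_ctrlTransform {ξ' : Z'} (hξ : IsClosed ({π ξ'} : Set Z))
    (hπ : IsBlowup π (vanishingIdeal ⟨{π ξ'}, hξ⟩)) (E : IdealExponent Z) :
    (stalkIdeal (E.transform π ⟨{π ξ'}, hξ⟩).J ξ').map (hπ.stalkEmb ξ').rangeRestrict =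
      @ctrlTransform Z.functionField _ E.b (algebraMap (Z.presheaf.stalk (π ξ')) Z.functionField).range
        (isLocalRing_range_algebraMap_stalk (Z := Z) (π ξ'))
        ((stalkIdeal E.J (π ξ')).map (algebraMap (Z.presheaf.stalk (π ξ')) Z.functionField).rangeRestrict)
        (hπ.stalkEmb ξ').range := by
  haveI := isLocalRing_range_algebraMap_stalk (Z := Z) (π ξ')
  set ι := algebraMap (Z.presheaf.stalk (π ξ')) Z.functionField with hι
  have hle : ι.range ≤ (hπ.stalkEmb ξ').range :=
    (toSubring_fibreSubalgebra_eq_range hπ rfl) ▸ range_algebraMap_stalk_le_fibreSubalgebra hπ ξ'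
  -- the isomorphism `𝒪_{Z′,ξ′} ≅ ε(𝒪_{Z′,ξ′})` as a bijective ring map
  let eS : Z'.presheaf.stalk ξ' ≃+* (hπ.stalkEmb ξ').range := RingEquiv.ofBijective (hπ.stalkEmb ξ').rangeRestrict
    ⟨fun _ _ h => hπ.stalkEmb_injective ξ' (congrArg Subtype.val h), (hπ.stalkEmb ξ').rangeRestrict_surjective⟩
  have heS : eS.toRingHom = (hπ.stalkEmb ξ').rangeRestrict := rfl
  have hJ' : (E.transform π ⟨{π ξ'}, hξ⟩).J = controlledTransform π (vanishingIdeal ⟨{π ξ'}, hξ⟩) E.J E.b := rfl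
  rw [hJ', hπ.stalkIdeal_controlledTransform E.J E.b ξ', ← heS, map_colon_eq_of_ringEquiv, Ideal.map_pow,
    stalkIdeal_comap_eq_map_stalkMap, stalkIdeal_comap_eq_map_stalkMap,
    stalkIdeal_vanishingIdeal_singleton (X := Z) hξ, Ideal.map_map, Ideal.map_map, heS,
    rangeRestrict_stalkEmb_comp_stalkMap hπ ξ', ← Ideal.map_map, ← Ideal.map_map, map_rangeRestrict_maximalIdeal,
    ctrlTransform, extIdeal_eq_map _ hle, extIdeal_eq_map _ hle]

omit [IsIntegral Z'] in
/-- The ideal identity with the base point named (`h : π ξ′ = ξ`). [cite: ZariskiSamuel1960, Appendix 5] -/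
theorem map_rangeRestrict_stalkIdeal_transform_eq_ctrlTransform' {ξ : Z} {ξ' : Z'} (h : π ξ' = ξ)
    (hξ : IsClosed ({ξ} : Set Z)) (hπ : IsBlowup π (vanishingIdeal ⟨{ξ}, hξ⟩)) (E : IdealExponent Z) :
    (stalkIdeal (E.transform π ⟨{ξ}, hξ⟩).J ξ').map (hπ.stalkEmb ξ').rangeRestrict =
      @ctrlTransform Z.functionField _ E.b (algebraMap (Z.presheaf.stalk ξ) Z.functionField).range
        (isLocalRing_range_algebraMap_stalk (Z := Z) ξ)
        ((stalkIdeal E.J ξ).map (algebraMap (Z.presheaf.stalk ξ) Z.functionField).rangeRestrict)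
        (hπ.stalkEmb ξ').range := by
  subst h
  exact map_rangeRestrict_stalkIdeal_transform_eq_ctrlTransform hξ hπ E

/-- The quadratic-transform statement with the base point named (`h : π ξ′ = ξ`). [cite: Cutkosky2014, §2.1] -/
theorem isQuadraticTransform_range_stalkEmb' (hπ : IsBlowup π J) {ξ : Z} {ξ' : Z'} (h : π ξ' = ξ)
    (hJ : stalkIdeal J ξ = maximalIdeal (Z.presheaf.stalk ξ)) :
    IsQuadraticTransform (algebraMap (Z.presheaf.stalk ξ) Z.functionField).range (hπ.stalkEmb ξ').range := by
  subst h
  exact isQuadraticTransform_range_stalkEmb hπ ξ' hJ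

omit [IsIntegral Z'] in
/-- Domination with the base point named. [cite: Cutkosky2014, §2.1] -/
theorem subringDominates_range_stalkEmb (hπ : IsBlowup π J) {ξ : Z} {ξ' : Z'} (h : π ξ' = ξ) :
    SubringDominates (algebraMap (Z.presheaf.stalk ξ) Z.functionField).range (hπ.stalkEmb ξ').range := by
  subst h
  rw [← toSubring_fibreSubalgebra_eq_range hπ rfl]
  exact subringDominates_fibreSubalgebra hπ ξ'

end RangeCurrency

/-! ## The root node is tame -/

variable {p : ℕ} [Fact p.Prime] {K : Type u} [Field K] [CharP K p]

/-- **The root node `⟨R, I⟩ = (𝒪_{Z,ξ}, J_ξ)` read in `K(Z)` is a TAME node of exponent `b`** for a permissible blow-up of the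
closed point `ξ ∈ Sing(E)` with `dim 𝒪_{Z,ξ} = 2` whose transform lies in `regimePlaneIsolated` (regularity of the ambient
stalk; `K(Z)` is the fraction field; `J_ξ ⊆ 𝔪^b`; `J_ξ ⊄ 𝔪^{2b}` by part 1). [folklore] -/
theorem isTameNode_range_of_regime {A A' : AmbientDatum p K} {E : IdealExponent A.Z} {E' : IdealExponent A'.Z}
    {ξ : A.Z} {hξ : IsClosed ({ξ} : Set A.Z)} {π : A'.Z ⟶ A.Z} (hRg' : regimePlaneIsolated A' E')
    (hξS : ξ ∈ E.sing) (hD : E.IsPermissibleCentre A.hom ⟨{ξ}, hξ⟩) (hπ : IsBlowup π (vanishingIdeal ⟨{ξ}, hξ⟩))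
    (hEE' : E' = E.transform π ⟨{ξ}, hξ⟩) (hdim : ringKrullDim (A.Z.presheaf.stalk ξ) = 2) :
    haveI := ambient_isIntegral A
    IsTameNode E.b (⟨(algebraMap (A.Z.presheaf.stalk ξ) A.Z.functionField).range,
      (stalkIdeal E.J ξ).map (algebraMap (A.Z.presheaf.stalk ξ) A.Z.functionField).rangeRestrict⟩ :
        MarkedNode A.Z.functionField) := by
  haveI := ambient_isIntegral A
  haveI : IsRegularLocalRing (A.Z.presheaf.stalk ξ) := ambient_isRegular A ξ
  haveI hreg : IsRegularLocalRing (algebraMap (A.Z.presheaf.stalk ξ) A.Z.functionField).range := isRegularLocalRing_range_of ξ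
  set ι := algebraMap (A.Z.presheaf.stalk ξ) A.Z.functionField with hι
  have hinj : Function.Injective ι := algebraMap_stalk_functionField_injective ξ
  have hbij : Function.Bijective ι.rangeRestrict :=
    ⟨fun _ _ h => hinj (congrArg Subtype.val h), ι.rangeRestrict_surjective⟩
  refine ⟨hreg, (ringKrullDim_range_algebraMap_stalk ξ).trans hdim, isLocalRingOf_range_algebraMap_stalk ξ, ?_, ?_⟩
  · -- `I ≤ 𝔪_R^b`
    have h := Ideal.map_mono (f := ι.rangeRestrict) ((mem_sing_iff_stalkIdeal_le_pow E ξ).mp hξS)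
    rw [Ideal.map_pow, map_rangeRestrict_maximalIdeal] at h
    exact h
  · -- `I ⊄ 𝔪_R^{2b}`
    intro hle
    apply stalkIdeal_not_le_pow_two_mul_of_regime hRg' hD hπ hEE' hdim
    have h := Ideal.comap_mono (f := ι.rangeRestrict) hle
    rw [Ideal.comap_map_of_bijective _ hbij, ← map_rangeRestrict_maximalIdeal, ← Ideal.map_pow,
      Ideal.comap_map_of_bijective _ hbij] at h
    exact h

end CampaignW46

end Summit.ResolutionOfSingularities.ResolutionOfSingularities.Theorems

end
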